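import Summits.HubbardSuperconductivity.HubbardSuperconductivity.Theorems.AnisotropyChordTransferFibre3FinX3Eval

/-!
# Route `AnisotropyChord` / H0 rotor rung: FIN per-`L` GM₃ (X5), `L = 35` — rows `N₁` / D / side-condition cell facts, part `p49`

Kernel facts (`decide +kernel`) for cert cells 118, 119 of the per-`L` grid of `L = 35`: `xbnCellAny2` (row `N₁` on XB2 point wedges recomputed in the kernel, exporting the literal brackets `nt ⊇ T⁺ − 3λ₂` and `tb ⊇ T⁺·D`), `xdCellAnyN0` (row D, reads `nt`), `sdCellAnyZN` (side condition, reads `nt`); evaluators `…FinX3Eval` / `…FinX5Eval`; constants from the compiled design probe (x3probe/x3plan, margins c ×0.985, b ×1.03, aD ×1.03); assembled in `…FinX5GM3ThirtyFive`.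
Prover seat `hubbard-h0-rotor-p3` g8; helper for piece A = stmt-HubbardSuperconductivity-23918 of rung 19089 (`--supports`, helper class).
WHAT THIS IS NOT: nothing here proves superconductivity in the Hubbard model (rotor TARGET as worded stays FALSE, g15 verdict); kernel facts for the FIN certificate of ONE conditional reduction.  Tree imports only; zero data; standard axioms.
-/

set_option linter.dupNamespace false
set_option autoImplicit false

namespace Summit.HubbardSuperconductivity.HubbardSuperconductivity.Theorems.AnisotropyChord.Transfer.Fibre3

namespace FinXD

open FinXB FinCell Hole2

set_option maxHeartbeats 4000000 in
/-- row `N₁` of cell 118 of `L = 35` (`c = 117/200`), exporting `nt`, `tb`. [folklore] -/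
theorem xn35_118 : xbnCellAny2 35 (49/50 : ℚ) 784213588258510 803818927964973 (117/200 : ℚ) ((9014508633194 : ℤ), (13049202709568 : ℤ)) ((2361640914029056 : ℤ), (2424520345984155 : ℤ)) = true := by decide +kernel

set_option maxHeartbeats 4000000 in
/-- row D of cell 118 of `L = 35` (`aD = 2/25`). [folklore] -/
theorem xd35_118 : xdCellAnyN0 35 (49/50 : ℚ) 784213588258510 803818927964973 (2/25 : ℚ) ((9014508633194 : ℤ), (13049202709568 : ℤ)) = true := by decide +kernel

set_option maxHeartbeats 4000000 in
/-- side condition of cell 118 of `L = 35` (`c, b = 95/100, aD`). [folklore] -/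
theorem sd35_118 : sdCellAnyZN 35 (49/50 : ℚ) 100 784213588258510 803818927964973 ((117/200 : ℚ), (95 : ℕ), (2/25 : ℚ)) ((9014508633194 : ℤ), (13049202709568 : ℤ)) = true := by decide +kernel

set_option maxHeartbeats 4000000 in
/-- row `N₁` of cell 119 of `L = 35` (`c = 117/200`), exporting `nt`, `tb`. [folklore] -/
theorem xn35_119 : xbnCellAny2 35 (49/50 : ℚ) 803818927964973 823914401164097 (117/200 : ℚ) ((9694922069013 : ℤ), (13944074173377 : ℤ)) ((2421136987599773 : ℤ), (2485701996029827 : ℤ)) = true := by decide +kernel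

set_option maxHeartbeats 4000000 in
/-- row D of cell 119 of `L = 35` (`aD = 2/25`). [folklore] -/
theorem xd35_119 : xdCellAnyN0 35 (49/50 : ℚ) 803818927964973 823914401164097 (2/25 : ℚ) ((9694922069013 : ℤ), (13944074173377 : ℤ)) = true := by decide +kernel

set_option maxHeartbeats 4000000 in
/-- side condition of cell 119 of `L = 35` (`c, b = 97/100, aD`). [folklore] -/
theorem sd35_119 : sdCellAnyZN 35 (49/50 : ℚ) 100 803818927964973 823914401164097 ((117/200 : ℚ), (97 : ℕ), (2/25 : ℚ)) ((9694922069013 : ℤ), (13944074173377 : ℤ)) = true := by decide +kernel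

end FinXD

end Summit.HubbardSuperconductivity.HubbardSuperconductivity.Theorems.AnisotropyChord.Transfer.Fibre3
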